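import Mathlib
import Summits.ValiantsHypothesis.ValiantsHypothesis.Theses.LiouvilleSarnak
import Summits.ValiantsHypothesis.ValiantsHypothesis.Theorems.LiouvilleSarnakAlignedCutRank
import Summits.ValiantsHypothesis.ValiantsHypothesis.Theorems.LiouvilleSarnakLiouvilleCutRankGramCount

/-!
# Route LiouvilleSarnak — the two registered OPEN stubs, linked at ONE scale:
# `stub_twoPointDigital` (line `tt_star`, crux `DigitalBilinearLiouville`, stmt-ValiantsHypothesis-14774)
# bounds `stub_rankAtOneScale` (line `one_scale`, crux `LiouvilleCutRank`, stmt-ValiantsHypothesis-14775)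

The two live skeletons of the route each have exactly one open stub:

* `tt_star.stub_twoPointDigital` — for every `ε > 0`, eventually every balanced cut `π` has
  pair-correlation (Gram) sum `G_π := Σ_{r,r'} ‖Σ_c M_π(r,c) M_π(r',c)‖² ≤ ε 16^n`;
* `one_scale.stub_rankAtOneScale` — for every `W` there is ONE level `n₁` at which every balanced cut
  matrix `M_{π₁}` has rank `≥ W`.

This file records the quantitative, scale-by-scale implication between them — for ONE cut at ONE
level, no `n₀`, no limit, and no spectral theorem:

* §1 `card_sq_mul_card_sq_le_image_mul_gram` — for ANY `±1` matrix `B` (`ι × κ`):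
  `|ι|² |κ|² ≤ #{distinct rows of B} · Σ_{r,r'} ⟨B r, B r'⟩²`
  (the two counting lemmas of the landed `…GramCount`: Cauchy–Schwarz on the row fibres, and "equal
  rows have inner product `|κ|`").
* §2 ★ `sixteen_pow_le_two_pow_rank_mul_gram` — for the Liouville cut matrix of ANY cut `π` at ANY
  level `n`: `16^n ≤ 2^{rank M_π} · G_π` (§1 and "a `±1` matrix has `≤ 2^{rank}` distinct rows",
  `LiouvilleSarnakAligned.card_image_row_le_two_pow_rank`).  So `G_π ≤ ε 16^n` forces `2^{rank M_π} ≥ 1/ε`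
  (`le_rank_of_gram_le`), pointwise in `(n, π)`.
* §3 ★ `rankAtOneScale_of_twoPointAtOneScale` — the ONE-SCALE form of `stub_twoPointDigital`
  (`∀ ε ∃ n₁ ∀ π₁, G_{π₁} ≤ ε 16^{n₁}`) implies the registered `stub_rankAtOneScale` VERBATIM
  (`∀ W ∃ n₁ ∀ π₁, W ≤ rank M_{π₁}`), at the SAME level `n₁` (`ε = 2^{-W}`).
* §4 `liouvilleCutRank_of_twoPointDigital` — the registered `stub_twoPointDigital` VERBATIM implies the
  crux `LiouvilleCutRank` by name (directly from §2; a second route is the landed composition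
  `TtStar.digitalBilinearLiouville_of_twoPointDigital` ∘ `BilinearImpliesCutRank`).

Honest framing: bridges only — BOTH stubs and both cruxes (`DigitalBilinearLiouville`, `LiouvilleCutRank`)
stay OPEN, `AlgebraicSarnak` stays open, and nothing here bears on `VP ≠ VNP`.  For the census: an
argument giving `G_π = o(16^n)` at ONE level for ALL cuts closes the open stub of line `one_scale` at
that level; conversely a bad cut family for 14775 (rank `< W`) has `G_π ≥ 16^n / 2^W` at every one of
its levels (many pairs of equal rows).  No definitions.
-/

-- the directory `ValiantsHypothesis/ValiantsHypothesis` repeats the summit name (tree layout)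
set_option linter.dupNamespace false

namespace Summit.ValiantsHypothesis.ValiantsHypothesis.Theorems.LiouvilleSarnakDigitalBilinearLiouville.TtStarCutRank

open Finset ArithmeticFunction
open Summit.ValiantsHypothesis.ValiantsHypothesis.Theses.LiouvilleSarnak (LiouvilleCutRank)
open Summit.ValiantsHypothesis.ValiantsHypothesis.Theorems.LiouvilleSarnakAligned
  (card_image_row_le_two_pow_rank)
open Summit.ValiantsHypothesis.ValiantsHypothesis.Theorems.LiouvilleSarnakLiouvilleCutRank.GramCount
  (card_sq_le_card_image_mul_equalPairs sq_card_mul_equalPairs_le_gram)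

/-! ### §1 Sign matrices: `|ι|² |κ|² ≤ #distinct rows · Gram` -/

/-- **Distinct rows versus the Gram sum** for a `±1` matrix `B : ι × κ`:
`|ι|² · |κ|² ≤ #{distinct rows} · Σ_{(r,r')} (Σ_c B_rc B_r'c)²`.  (Cauchy–Schwarz on the fibres of the
row map gives `|ι|² ≤ #rows · #{equal pairs}`, and each pair of equal rows contributes `|κ|²` to the
Gram sum.) [folklore] -/
theorem card_sq_mul_card_sq_le_image_mul_gram {ι κ : Type*} [Fintype ι] [Fintype κ] [DecidableEq ι]
    [DecidableEq κ] (B : ι → κ → ℤ) (hB : ∀ r c, B r c = 1 ∨ B r c = -1) :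
    (Fintype.card ι : ℤ) ^ 2 * (Fintype.card κ : ℤ) ^ 2 ≤
      (((univ : Finset ι).image B).card : ℤ) *
        ∑ p ∈ (univ : Finset ι) ×ˢ (univ : Finset ι), (∑ c, B p.1 c * B p.2 c) ^ 2 := by
  have h1 := card_sq_le_card_image_mul_equalPairs B
  have h2 := sq_card_mul_equalPairs_le_gram B hB
  have h1' : (Fintype.card ι : ℤ) ^ 2 ≤
      (((univ : Finset ι).image B).card : ℤ) *
        ∑ r : ι, (((univ : Finset ι).filter fun r' => B r' = B r).card : ℤ) := by
    exact_mod_cast h1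
  have hE0 : (0 : ℤ) ≤ ∑ r : ι, (((univ : Finset ι).filter fun r' => B r' = B r).card : ℤ) := by
    positivity
  calc (Fintype.card ι : ℤ) ^ 2 * (Fintype.card κ : ℤ) ^ 2
      ≤ ((((univ : Finset ι).image B).card : ℤ) *
          ∑ r : ι, (((univ : Finset ι).filter fun r' => B r' = B r).card : ℤ)) *
          (Fintype.card κ : ℤ) ^ 2 := mul_le_mul_of_nonneg_right h1' (sq_nonneg _)
    _ = (((univ : Finset ι).image B).card : ℤ) *
          ((Fintype.card κ : ℤ) ^ 2 *
            ∑ r : ι, (((univ : Finset ι).filter fun r' => B r' = B r).card : ℤ)) := by ring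
    _ ≤ (((univ : Finset ι).image B).card : ℤ) *
          ∑ p ∈ (univ : Finset ι) ×ˢ (univ : Finset ι), (∑ c, B p.1 c * B p.2 c) ^ 2 :=
        mul_le_mul_of_nonneg_left h2 (by positivity)

/-! ### §2 The Liouville cut matrix: one cut, one level -/

/-- ★ **`16^n ≤ 2^{rank M_π} · G_π`, pointwise in `(n, π)`.**  For ANY level `n` and ANY balanced cut
`π`, the Liouville cut matrix `M_π(r,c) = λ(N_π(r,c)+1)` satisfies
`16^n ≤ 2^{rank M_π} · Σ_{r,r'} ‖Σ_c M_π(r,c) M_π(r',c)‖²`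
(§1 with `|ι| = |κ| = 2^n`, and `#distinct rows ≤ 2^{rank}` for a `±1` matrix). [folklore] -/
theorem sixteen_pow_le_two_pow_rank_mul_gram (n : ℕ) (π : Fin n ⊕ Fin n ≃ Fin (2 * n)) :
    (16 : ℝ) ^ n ≤
      2 ^ (Matrix.of fun r c : Fin n → Bool =>
        (((liouville (Nat.ofBits (fun j : Fin (2 * n) => Sum.elim r c (π.symm j)) + 1) : ℤ) : ℂ))).rank *
      (∑ r : Fin n → Bool, ∑ r' : Fin n → Bool,
        ‖∑ c : Fin n → Bool,
          ((liouville (Nat.ofBits (fun j : Fin (2 * n) => Sum.elim r c (π.symm j)) + 1) : ℤ) : ℂ) *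
          ((liouville (Nat.ofBits (fun j : Fin (2 * n) => Sum.elim r' c (π.symm j)) + 1) : ℤ) : ℂ)‖ ^ 2) := by
  classical
  set B : (Fin n → Bool) → (Fin n → Bool) → ℤ := fun r c =>
    liouville (Nat.ofBits (fun j : Fin (2 * n) => Sum.elim r c (π.symm j)) + 1) with hB
  set M : Matrix (Fin n → Bool) (Fin n → Bool) ℂ := Matrix.of fun r c : Fin n → Bool =>
    (((liouville (Nat.ofBits (fun j : Fin (2 * n) => Sum.elim r c (π.symm j)) + 1) : ℤ) : ℂ)) with hM
  have hMB : ∀ r c, M r c = ((B r c : ℤ) : ℂ) := fun r c => by rw [hM, Matrix.of_apply]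
  have hB1 : ∀ r c, B r c = 1 ∨ B r c = -1 := by
    intro r c
    have hBrc : B r c = liouville (Nat.ofBits (fun j : Fin (2 * n) => Sum.elim r c (π.symm j)) + 1) :=
      rfl
    rw [hBrc, liouville_apply (Nat.succ_ne_zero _)]
    exact neg_one_pow_eq_or ℤ _
  have hM1 : ∀ r c, M r c = 1 ∨ M r c = -1 := by
    intro r c
    rw [hMB]
    rcases hB1 r c with h | h
    · left; rw [h]; push_cast; rfl
    · right; rw [h]; push_cast; rfl
  -- §1 for `B`
  have key := card_sq_mul_card_sq_le_image_mul_gram B hB1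
  have hcard : (Fintype.card (Fin n → Bool) : ℤ) = 2 ^ n := by
    rw [Fintype.card_fun, Fintype.card_bool, Fintype.card_fin]; push_cast; ring
  rw [hcard] at key
  -- distinct rows of `B` = distinct rows of `M` ≤ 2^rank
  have himg : ((univ : Finset (Fin n → Bool)).image B).card ≤ 2 ^ M.rank := by
    have hinj : Function.Injective (fun v : (Fin n → Bool) → ℤ => fun c => ((v c : ℤ) : ℂ)) := by
      intro v w h
      funext c
      have := congr_fun h c
      simp only at this
      exact_mod_cast this
    have hcomp : (fun r => M r) = (fun v : (Fin n → Bool) → ℤ => fun c => ((v c : ℤ) : ℂ)) ∘ B := by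
      funext r c
      simp only [Function.comp_apply]
      exact hMB r c
    have hrows : ((univ : Finset (Fin n → Bool)).image fun r => M r) =
        ((univ : Finset (Fin n → Bool)).image B).image (fun v : (Fin n → Bool) → ℤ => fun c => ((v c : ℤ) : ℂ)) := by
      rw [hcomp, ← Finset.image_image]
    calc ((univ : Finset (Fin n → Bool)).image B).card
        = (((univ : Finset (Fin n → Bool)).image B).image
            (fun v : (Fin n → Bool) → ℤ => fun c => ((v c : ℤ) : ℂ))).card :=
          (card_image_of_injective _ hinj).symm
      _ = ((univ : Finset (Fin n → Bool)).image fun r => M r).card := by rw [hrows]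
      _ ≤ 2 ^ M.rank := card_image_row_le_two_pow_rank M hM1
  -- the integer Gram sum of `B`, cast to `ℝ`, is the complex-norm Gram sum of `M`
  have hG : (((∑ p ∈ (univ : Finset (Fin n → Bool)) ×ˢ (univ : Finset (Fin n → Bool)),
      (∑ c, B p.1 c * B p.2 c) ^ 2 : ℤ)) : ℝ) =
      ∑ r : Fin n → Bool, ∑ r' : Fin n → Bool, ‖∑ c : Fin n → Bool, M r c * M r' c‖ ^ 2 := by
    rw [Finset.sum_product]
    push_cast
    refine sum_congr rfl fun r _ => sum_congr rfl fun r' _ => ?_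
    have hc : (∑ c : Fin n → Bool, M r c * M r' c) = (((∑ c : Fin n → Bool, B r c * B r' c : ℤ)) : ℂ) := by
      push_cast
      exact sum_congr rfl fun c _ => by rw [hMB, hMB]
    rw [hc, Complex.norm_intCast, sq_abs]
    push_cast
    ring
  -- combine (over `ℝ`)
  have key' : ((2 : ℝ) ^ n) ^ 2 * ((2 : ℝ) ^ n) ^ 2 ≤
      (((univ : Finset (Fin n → Bool)).image B).card : ℝ) *
        ∑ r : Fin n → Bool, ∑ r' : Fin n → Bool, ‖∑ c : Fin n → Bool, M r c * M r' c‖ ^ 2 := by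
    rw [← hG]
    exact_mod_cast key
  have himg' : (((univ : Finset (Fin n → Bool)).image B).card : ℝ) ≤ (2 : ℝ) ^ M.rank := by
    exact_mod_cast himg
  have hG0 : (0 : ℝ) ≤ ∑ r : Fin n → Bool, ∑ r' : Fin n → Bool, ‖∑ c : Fin n → Bool, M r c * M r' c‖ ^ 2 := by
    positivity
  have h16 : (16 : ℝ) ^ n = ((2 : ℝ) ^ n) ^ 2 * ((2 : ℝ) ^ n) ^ 2 := by
    rw [← pow_mul, ← pow_add, show (16 : ℝ) = 2 ^ 4 by norm_num, ← pow_mul]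
    ring_nf
  have hfinal : (16 : ℝ) ^ n ≤ (2 : ℝ) ^ M.rank *
      ∑ r : Fin n → Bool, ∑ r' : Fin n → Bool, ‖∑ c : Fin n → Bool, M r c * M r' c‖ ^ 2 := by
    rw [h16]
    exact key'.trans (mul_le_mul_of_nonneg_right himg' hG0)
  simpa only [hMB] using hfinal

/-- **Pair correlations bound the rank, pointwise in `(n, π)`.**  If the Gram sum of the Liouville cut
matrix of `π` (any level `n`) is `≤ ε · 16^n`, then `1 ≤ ε · 2^{rank M_π}`. [folklore] -/
theorem one_le_mul_two_pow_rank_of_gram_le (n : ℕ) (π : Fin n ⊕ Fin n ≃ Fin (2 * n)) {ε : ℝ}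
    (hG : (∑ r : Fin n → Bool, ∑ r' : Fin n → Bool,
        ‖∑ c : Fin n → Bool,
          ((liouville (Nat.ofBits (fun j : Fin (2 * n) => Sum.elim r c (π.symm j)) + 1) : ℤ) : ℂ) *
          ((liouville (Nat.ofBits (fun j : Fin (2 * n) => Sum.elim r' c (π.symm j)) + 1) : ℤ) : ℂ)‖ ^ 2) ≤
      ε * 16 ^ n) :
    (1 : ℝ) ≤ ε * 2 ^ (Matrix.of fun r c : Fin n → Bool =>
      (((liouville (Nat.ofBits (fun j : Fin (2 * n) => Sum.elim r c (π.symm j)) + 1) : ℤ) : ℂ))).rank := by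
  have key := sixteen_pow_le_two_pow_rank_mul_gram n π
  have h16 : (0 : ℝ) < 16 ^ n := by positivity
  have h2 : (0 : ℝ) ≤ 2 ^ (Matrix.of fun r c : Fin n → Bool =>
      (((liouville (Nat.ofBits (fun j : Fin (2 * n) => Sum.elim r c (π.symm j)) + 1) : ℤ) : ℂ))).rank := by
    positivity
  have := key.trans (mul_le_mul_of_nonneg_left hG h2)
  -- `16^n ≤ 2^rank · ε · 16^n`
  have h' : (16 : ℝ) ^ n * 1 ≤ 16 ^ n * (ε * 2 ^ (Matrix.of fun r c : Fin n → Bool =>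
      (((liouville (Nat.ofBits (fun j : Fin (2 * n) => Sum.elim r c (π.symm j)) + 1) : ℤ) : ℂ))).rank) := by
    rw [mul_one]
    linarith
  exact le_of_mul_le_mul_left h' h16

/-- **Rank from a Gram bound, pointwise:** `G_π ≤ 2^{-W} · 16^n ⟹ W ≤ rank M_π`. [folklore] -/
theorem le_rank_of_gram_le (n W : ℕ) (π : Fin n ⊕ Fin n ≃ Fin (2 * n))
    (hG : (∑ r : Fin n → Bool, ∑ r' : Fin n → Bool,
        ‖∑ c : Fin n → Bool,
          ((liouville (Nat.ofBits (fun j : Fin (2 * n) => Sum.elim r c (π.symm j)) + 1) : ℤ) : ℂ) *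
          ((liouville (Nat.ofBits (fun j : Fin (2 * n) => Sum.elim r' c (π.symm j)) + 1) : ℤ) : ℂ)‖ ^ 2) ≤
      (1 / 2 ^ W) * 16 ^ n) :
    W ≤ (Matrix.of fun r c : Fin n → Bool =>
      (((liouville (Nat.ofBits (fun j : Fin (2 * n) => Sum.elim r c (π.symm j)) + 1) : ℤ) : ℂ))).rank := by
  have h1 := one_le_mul_two_pow_rank_of_gram_le n π hG
  set ρ := (Matrix.of fun r c : Fin n → Bool =>
      (((liouville (Nat.ofBits (fun j : Fin (2 * n) => Sum.elim r c (π.symm j)) + 1) : ℤ) : ℂ))).rank with hρ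
  have h2W : (0 : ℝ) < 2 ^ W := by positivity
  have h2 : (2 : ℝ) ^ W ≤ 2 ^ ρ := by
    rw [one_div, ← div_eq_inv_mul, le_div_iff₀ h2W, one_mul] at h1
    exact h1
  exact le_of_not_gt fun hlt => by
    have : (2 : ℝ) ^ ρ < 2 ^ W := pow_lt_pow_right₀ (by norm_num) hlt
    linarith

/-! ### §3 One-scale two-point decorrelation ⟹ the registered `stub_rankAtOneScale` -/

/-- ★ **The open stubs at ONE scale.**  If for every `ε > 0` there is ONE level `n₁` at which every
balanced cut has pair-correlation sum `≤ ε · 16^{n₁}` (the one-scale form of `tt_star.stub_twoPointDigital`),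
then for every `W` there is one level at which every balanced cut matrix has rank `≥ W` — the registered
`one_scale.stub_rankAtOneScale` verbatim (same level, `ε = 2^{-W}`). [folklore] -/
theorem rankAtOneScale_of_twoPointAtOneScale
    (h : ∀ ε : ℝ, 0 < ε → ∃ n₁ : ℕ, ∀ π₁ : Fin n₁ ⊕ Fin n₁ ≃ Fin (2 * n₁),
      (∑ r : Fin n₁ → Bool, ∑ r' : Fin n₁ → Bool,
        ‖∑ c : Fin n₁ → Bool,
          ((liouville (Nat.ofBits (fun j : Fin (2 * n₁) => Sum.elim r c (π₁.symm j)) + 1) : ℤ) : ℂ) *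
          ((liouville (Nat.ofBits (fun j : Fin (2 * n₁) => Sum.elim r' c (π₁.symm j)) + 1) : ℤ) : ℂ)‖ ^ 2) ≤
      ε * 16 ^ n₁) :
    ∀ W : ℕ, ∃ n₁ : ℕ, ∀ π₁ : Fin n₁ ⊕ Fin n₁ ≃ Fin (2 * n₁),
      W ≤ (Matrix.of fun r c : Fin n₁ → Bool =>
        (((liouville (Nat.ofBits (fun j : Fin (2 * n₁) => Sum.elim r c (π₁.symm j)) + 1) : ℤ) : ℂ))).rank := by
  intro W
  obtain ⟨n₁, hn₁⟩ := h (1 / 2 ^ W) (by positivity)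
  exact ⟨n₁, fun π₁ => le_rank_of_gram_le n₁ W π₁ (hn₁ π₁)⟩

/-! ### §4 The registered `stub_twoPointDigital` ⟹ the crux `LiouvilleCutRank`, by name -/

/-- **`stub_twoPointDigital` ⟹ `LiouvilleCutRank`.**  The open stub of line `tt_star` (verbatim, as a
hypothesis) implies the crux stmt-ValiantsHypothesis-14775 by name, directly from §2 (`ε = 2^{-W}`, same
`n₀`).  (Second route in the tree: `TtStar.digitalBilinearLiouville_of_twoPointDigital` composed with the
support `BilinearImpliesCutRank`.) [folklore] -/
theorem liouvilleCutRank_of_twoPointDigital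
    (h2 : ∀ ε : ℝ, 0 < ε → ∃ n₀ : ℕ, ∀ n ≥ n₀, ∀ π : Fin n ⊕ Fin n ≃ Fin (2 * n),
      (∑ r : Fin n → Bool, ∑ r' : Fin n → Bool,
        ‖∑ c : Fin n → Bool,
          ((liouville (Nat.ofBits (fun j : Fin (2 * n) => Sum.elim r c (π.symm j)) + 1) : ℤ) : ℂ) *
          ((liouville (Nat.ofBits (fun j : Fin (2 * n) => Sum.elim r' c (π.symm j)) + 1) : ℤ) : ℂ)‖ ^ 2) ≤
      ε * 16 ^ n) :
    LiouvilleCutRank := by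
  intro W
  obtain ⟨n₀, hn₀⟩ := h2 (1 / 2 ^ W) (by positivity)
  exact ⟨n₀, fun n hn π => le_rank_of_gram_le n W π (hn₀ n hn π)⟩

/-! ### §5 (appended) Bad cuts have many pairs of EQUAL rows -/

/-- **Distinct rows of the Liouville cut matrix are at most `2^{rank}`** — the integer-valued row map
`r ↦ (c ↦ λ(N_π(r,c)+1))` has at most `2^{rank M_π}` distinct values (the complex cut matrix is the injective
image of the integer one; `LiouvilleSarnakAligned.card_image_row_le_two_pow_rank`). [folklore] -/
theorem card_image_rows_le_two_pow_rank (n : ℕ) (π : Fin n ⊕ Fin n ≃ Fin (2 * n)) :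
    ((univ : Finset (Fin n → Bool)).image (fun r c : Fin n → Bool =>
        liouville (Nat.ofBits (fun j : Fin (2 * n) => Sum.elim r c (π.symm j)) + 1))).card ≤
      2 ^ (Matrix.of fun r c : Fin n → Bool =>
        (((liouville (Nat.ofBits (fun j : Fin (2 * n) => Sum.elim r c (π.symm j)) + 1) : ℤ) : ℂ))).rank := by
  classical
  set B : (Fin n → Bool) → (Fin n → Bool) → ℤ := fun r c =>
    liouville (Nat.ofBits (fun j : Fin (2 * n) => Sum.elim r c (π.symm j)) + 1) with hB
  set M : Matrix (Fin n → Bool) (Fin n → Bool) ℂ := Matrix.of fun r c : Fin n → Bool =>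
    (((liouville (Nat.ofBits (fun j : Fin (2 * n) => Sum.elim r c (π.symm j)) + 1) : ℤ) : ℂ)) with hM
  have hMB : ∀ r c, M r c = ((B r c : ℤ) : ℂ) := fun r c => by rw [hM, Matrix.of_apply]
  have hB1 : ∀ r c, B r c = 1 ∨ B r c = -1 := by
    intro r c
    have hBrc : B r c = liouville (Nat.ofBits (fun j : Fin (2 * n) => Sum.elim r c (π.symm j)) + 1) :=
      rfl
    rw [hBrc, liouville_apply (Nat.succ_ne_zero _)]
    exact neg_one_pow_eq_or ℤ _
  have hM1 : ∀ r c, M r c = 1 ∨ M r c = -1 := by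
    intro r c
    rw [hMB]
    rcases hB1 r c with h | h
    · left; rw [h]; push_cast; rfl
    · right; rw [h]; push_cast; rfl
  have hinj : Function.Injective (fun v : (Fin n → Bool) → ℤ => fun c => ((v c : ℤ) : ℂ)) := by
    intro v w h
    funext c
    have := congr_fun h c
    simp only at this
    exact_mod_cast this
  have hcomp : (fun r => M r) = (fun v : (Fin n → Bool) → ℤ => fun c => ((v c : ℤ) : ℂ)) ∘ B := by
    funext r c
    simp only [Function.comp_apply]
    exact hMB r c
  have hrows : ((univ : Finset (Fin n → Bool)).image fun r => M r) =
      ((univ : Finset (Fin n → Bool)).image B).image (fun v : (Fin n → Bool) → ℤ => fun c => ((v c : ℤ) : ℂ)) := by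
    rw [hcomp, ← Finset.image_image]
  calc ((univ : Finset (Fin n → Bool)).image B).card
      = (((univ : Finset (Fin n → Bool)).image B).image
          (fun v : (Fin n → Bool) → ℤ => fun c => ((v c : ℤ) : ℂ))).card :=
        (card_image_of_injective _ hinj).symm
    _ = ((univ : Finset (Fin n → Bool)).image fun r => M r).card := by rw [hrows]
    _ ≤ 2 ^ M.rank := card_image_row_le_two_pow_rank M hM1

/-- ★ **Bad cuts have many pairs of EQUAL rows.**  For EVERY cut `π` at EVERY level `n`:
`4^n ≤ 2^{rank M_π} · #{(r, r') : row r' of M_π = row r of M_π}` (ordered pairs, diagonal included), i.e. a cut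
with `rank M_π < W` has at least `4^n / 2^W` ordered pairs of rows `r, r'` with
`λ(N_π(r',c)+1) = λ(N_π(r,c)+1)` for ALL `2^n` columns `c` — against the `2^n` trivial pairs `r = r'`.
(Cauchy–Schwarz on the fibres of the row map, `GramCount.card_sq_le_card_image_mul_equalPairs`, and
`card_image_rows_le_two_pow_rank`.) [folklore] -/
theorem four_pow_le_two_pow_rank_mul_card_equalRows (n : ℕ) (π : Fin n ⊕ Fin n ≃ Fin (2 * n)) :
    4 ^ n ≤ 2 ^ (Matrix.of fun r c : Fin n → Bool =>
        (((liouville (Nat.ofBits (fun j : Fin (2 * n) => Sum.elim r c (π.symm j)) + 1) : ℤ) : ℂ))).rank *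
      ∑ r : Fin n → Bool, ((univ : Finset (Fin n → Bool)).filter fun r' : Fin n → Bool =>
        ∀ c : Fin n → Bool,
          liouville (Nat.ofBits (fun j : Fin (2 * n) => Sum.elim r' c (π.symm j)) + 1) =
          liouville (Nat.ofBits (fun j : Fin (2 * n) => Sum.elim r c (π.symm j)) + 1)).card := by
  classical
  set B : (Fin n → Bool) → (Fin n → Bool) → ℤ := fun r c =>
    liouville (Nat.ofBits (fun j : Fin (2 * n) => Sum.elim r c (π.symm j)) + 1) with hB
  have h1 := card_sq_le_card_image_mul_equalPairs B
  have hcard : Fintype.card (Fin n → Bool) ^ 2 = 4 ^ n := by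
    rw [Fintype.card_fun, Fintype.card_bool, Fintype.card_fin, ← pow_mul,
      show (4 : ℕ) = 2 ^ 2 by norm_num, ← pow_mul, Nat.mul_comm]
  rw [hcard] at h1
  have himg := card_image_rows_le_two_pow_rank n π
  -- the two filters agree (`B r' = B r` iff equality at every column)
  have hfilter : ∀ r : Fin n → Bool,
      ((univ : Finset (Fin n → Bool)).filter fun r' => B r' = B r) =
      ((univ : Finset (Fin n → Bool)).filter fun r' : Fin n → Bool =>
        ∀ c : Fin n → Bool,
          liouville (Nat.ofBits (fun j : Fin (2 * n) => Sum.elim r' c (π.symm j)) + 1) =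
          liouville (Nat.ofBits (fun j : Fin (2 * n) => Sum.elim r c (π.symm j)) + 1)) := by
    intro r
    refine Finset.filter_congr fun r' _ => ?_
    constructor
    · intro h c
      have := congr_fun h c
      simpa only [hB] using this
    · intro h
      funext c
      simpa only [hB] using h c
  have hsum : (∑ r : Fin n → Bool, ((univ : Finset (Fin n → Bool)).filter fun r' => B r' = B r).card) =
      ∑ r : Fin n → Bool, ((univ : Finset (Fin n → Bool)).filter fun r' : Fin n → Bool =>
        ∀ c : Fin n → Bool,
          liouville (Nat.ofBits (fun j : Fin (2 * n) => Sum.elim r' c (π.symm j)) + 1) =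
          liouville (Nat.ofBits (fun j : Fin (2 * n) => Sum.elim r c (π.symm j)) + 1)).card :=
    Finset.sum_congr rfl fun r _ => by rw [hfilter r]
  rw [← hsum]
  exact h1.trans (Nat.mul_le_mul_right _ himg)

/-! ### §6 (appended) Rank below the level forces two DISTINCT coinciding row families -/

/-- ★ **Rank `< n` forces a coincidence of two digital families of `λ`.**  For EVERY cut `π` at EVERY
level `n`: if `rank M_π < n` then there are two DIFFERENT row patterns `r ≠ r'` with
`λ(N_π(r',c)+1) = λ(N_π(r,c)+1)` for ALL `2^n` column patterns `c` (by §5, `#equal ordered pairs ≥ 4^n/2^{rank}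
> 2^n = #diagonal pairs`). [folklore] -/
theorem exists_ne_equalRows_of_rank_lt (n : ℕ) (π : Fin n ⊕ Fin n ≃ Fin (2 * n))
    (hlt : (Matrix.of fun r c : Fin n → Bool =>
        (((liouville (Nat.ofBits (fun j : Fin (2 * n) => Sum.elim r c (π.symm j)) + 1) : ℤ) : ℂ))).rank < n) :
    ∃ r r' : Fin n → Bool, r ≠ r' ∧ ∀ c : Fin n → Bool,
      liouville (Nat.ofBits (fun j : Fin (2 * n) => Sum.elim r' c (π.symm j)) + 1) =
      liouville (Nat.ofBits (fun j : Fin (2 * n) => Sum.elim r c (π.symm j)) + 1) := by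
  classical
  by_contra hne
  push Not at hne
  have key := four_pow_le_two_pow_rank_mul_card_equalRows n π
  -- every fibre is the singleton `{r}`
  have hfib : ∀ r : Fin n → Bool, ((univ : Finset (Fin n → Bool)).filter fun r' : Fin n → Bool =>
        ∀ c : Fin n → Bool,
          liouville (Nat.ofBits (fun j : Fin (2 * n) => Sum.elim r' c (π.symm j)) + 1) =
          liouville (Nat.ofBits (fun j : Fin (2 * n) => Sum.elim r c (π.symm j)) + 1)) = {r} := by
    intro r
    ext r'
    simp only [Finset.mem_filter, Finset.mem_univ, true_and, Finset.mem_singleton]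
    constructor
    · intro h
      by_contra hrr
      obtain ⟨c, hc⟩ := hne r r' (Ne.symm hrr)
      exact hc (h c)
    · rintro rfl; intro c; rfl
  simp only [hfib, Finset.card_singleton, Finset.sum_const, Finset.card_univ, smul_eq_mul, mul_one] at key
  rw [Fintype.card_fun, Fintype.card_bool, Fintype.card_fin] at key
  -- `4^n ≤ 2^rank · 2^n < 2^n · 2^n = 4^n`
  have h2 : 2 ^ (Matrix.of fun r c : Fin n → Bool =>
        (((liouville (Nat.ofBits (fun j : Fin (2 * n) => Sum.elim r c (π.symm j)) + 1) : ℤ) : ℂ))).rank < 2 ^ n :=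
    Nat.pow_lt_pow_right (by norm_num) hlt
  have h4 : 4 ^ n = 2 ^ n * 2 ^ n := by
    rw [← mul_pow]; norm_num
  have : 4 ^ n < 2 ^ n * 2 ^ n := lt_of_le_of_lt key (Nat.mul_lt_mul_of_pos_right h2 (by positivity))
  omega

end Summit.ValiantsHypothesis.ValiantsHypothesis.Theorems.LiouvilleSarnakDigitalBilinearLiouville.TtStarCutRank
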